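import Summits.Ventures.CertifiedManyBodySolver.Observables.PairLROTowerCharged
import HarnessLib

/-!
# OP1-C, part 4: a node at a GRID chemical potential `μ'` within `Δ` of a supporting slope — the bracket /
# μ-grid-with-interval-slack reading

HONEST FRAMING: first certified bounds on pairing observables; not a superconductivity verdict; a ceiling route,
never presence. Crew hubbard-obs (D-0042), seat hubbard-obs-p1 (`prover-hubbard-obs-p1-g8-0`). Zero compute; no
definition; no named fact; no `sorry`.

`liminf_pairFieldLRO_le_sq_of_onePoint_chargedStationary_bound_TT'` needs the charged rows AT a supporting slope
`μ_c ∈ [μ₋(n), μ₊(n)]`, which is only BOXED by certified chords (`chemPot_mem_cell_of_mem_Icc`), never known. A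
certificate is produced at a grid point `μ'`. Since
`[K_{μ_c}, W] = [K_{μ'}, W] + (μ' − μ_c)·[N̂, W]` and `|Re⟨ζ,[N̂, W_L]ζ⟩| ≤ C_q·L²` uniformly (for a charge-`q`
word `[N̂, W] = −qW`, so `C_q = |q|·sup|one-point density|`; for a multiplier-weighted sum of charged words the
triangle inequality), a node at `μ'` with `|μ' − μ_c| ≤ Δ` is a node at `μ_c` with the constant `c` lowered by
the INTERVAL SLACK `Δ·C_q` (`liminf_pairFieldLRO_le_sq_of_onePoint_chargedStationary_bound_TT'_near`): the
certified ceiling of a cell of half-width `Δ` is `(M + Δ·C_q)²`, `M = −(c − A + (Σμ_σ)(n/2 − ν))`, and a grid of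
cells covering the certified bracket `[μ_lo, μ_hi] ⊇ [μ₋(n), μ₊(n)]` certifies the maximum over its cells
(sr-mbsolver-menu-3 MENU3-TLPINCER §7.3 «μ-grid with interval slack»; hubbard-obs STATUS (eg1)).

References: T. Koma, H. Tasaki, J. Stat. Phys. 76 (1994) 745, Theorem 5 [KomaTasaki1994]; W. Pusz, S. L.
Woronowicz, Comm. Math. Phys. 58 (1978) 273, §1 [PuszWoronowicz1978]; D. Ruelle, *Statistical Mechanics* (1969)
§3.4 [Ruelle1969].
-/

noncomputable section

namespace Summit.Ventures.CertifiedManyBodySolver.Observables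

open Matrix Complex Finset Literature.MathematicalPhysics.QuantumLattice Literature.Probability.LatticeModels
open Literature.MathematicalPhysics.QuantumLattice.HubbardWave0 ThermodynamicLimit Filter Topology
open scoped ComplexOrder ComplexConjugate BigOperators

section Near

variable (g : Site 2 → ℝ)

/-- Moving the chemical potential of a charged row: `(H − μ_c N̂)W − W(H − μ_c N̂) =
((H − μ'N̂)W − W(H − μ'N̂)) + (μ' − μ_c)·(N̂W − WN̂)`. [folklore] -/
theorem commutator_sub_smul_totalNumber_shift {m : Type*} [Fintype m] [DecidableEq m]
    (H Nt W : Matrix m m ℂ) (μc μ' : ℂ) :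
    (H - μc • Nt) * W - W * (H - μc • Nt) =
      ((H - μ' • Nt) * W - W * (H - μ' • Nt)) + (μ' - μc) • (Nt * W - W * Nt) := by
  simp only [Matrix.sub_mul, Matrix.mul_sub, Matrix.smul_mul, Matrix.mul_smul, sub_smul, smul_sub]
  abel

/-- **OP1-C at a grid point: a node at `μ'` within `Δ` of a supporting slope `μ_c` is a node at `μ_c` with
interval slack `Δ·C_q`.** Hypotheses of `liminf_pairFieldLRO_le_sq_of_onePoint_chargedStationary_bound_TT'`
(with `μ_c ∈ [μ₋(n), μ₊(n)]`), except that the one-point bound (OP1-C) carries the charged row at the GRID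
chemical potential `μ'`, `|μ' − μ_c| ≤ Δ`, and a uniform bound `|Re⟨ζ,(N̂W_L − W_LN̂)ζ⟩| ≤ C_q·L²` on unit
vectors is supplied. Conclusion: `liminf_k u_k ≤ (c − Δ·C_q − A + (Σμ_σ)(n/2 − ν))²`, i.e. the ceiling
`(M + Δ·C_q)²`. [cite: KomaTasaki1994, Theorem 5] [cite: PuszWoronowicz1978, §1] [cite: Ruelle1969, §3.4] -/
theorem liminf_pairFieldLRO_le_sq_of_onePoint_chargedStationary_bound_TT'_near (t t' : ℝ) {U n : ℝ}
    (hU : 0 ≤ U) (hn0 : 0 < n) (hn2 : n < 2) {c A κ u ν : ℝ} (μ : Fin 2 → ℝ) (hκ : 0 ≤ κ)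
    (hu : energyDensityTT' t t' U n ≤ u) {μc μ' Δ Cq : ℝ}
    (hμc : μc ∈ Set.Icc (chemPotMinusTT' t t' U n) (chemPotPlusTT' t t' U n)) (hnear : |μ' - μc| ≤ Δ)
    {Λw : Finset (Site 2)} (wloc : FermionOp Λw)
    (hweven : wloc ∈ carEvenSubalgebra (Finset.univ : Finset (Orb (PolySite Λw))))
    (hwevenH : wlocᴴ ∈ carEvenSubalgebra (Finset.univ : Finset (Orb (PolySite Λw)))) (L₁ : ℕ)
    (hInjw : ∀ L : ℕ, L₁ ≤ L → Set.InjOn (Torus.proj (d := 2) L) ↑Λw)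
    {DN : ℝ} (LN : ℕ) (hDN : 0 ≤ DN)
    (hDDN₁ : ∀ (L : ℕ) [NeZero L] (hL : L₁ ≤ L), LN ≤ L → ∀ χ : Fock (Orb (FermionTorus 2 L)), star χ ⬝ᵥ χ = 1 →
      |(star χ ⬝ᵥ (((∑ v : TorusSite 2 L, relabel (Orb.translate v)
          (fermionEmbed (PolySite.toTorusEmb L (hInjw L hL)) (((1 / 2 : ℂ)) • (wloc + wlocᴴ)))) *
        ((∑ v : TorusSite 2 L, relabel (Orb.translate v)
          (fermionEmbed (PolySite.toTorusEmb L (hInjw L hL)) (((1 / 2 : ℂ)) • (wloc + wlocᴴ)))) * totalNumber -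
          totalNumber * (∑ v : TorusSite 2 L, relabel (Orb.translate v)
          (fermionEmbed (PolySite.toTorusEmb L (hInjw L hL)) (((1 / 2 : ℂ)) • (wloc + wlocᴴ))))) -
        ((∑ v : TorusSite 2 L, relabel (Orb.translate v)
          (fermionEmbed (PolySite.toTorusEmb L (hInjw L hL)) (((1 / 2 : ℂ)) • (wloc + wlocᴴ)))) * totalNumber -
          totalNumber * (∑ v : TorusSite 2 L, relabel (Orb.translate v)
          (fermionEmbed (PolySite.toTorusEmb L (hInjw L hL)) (((1 / 2 : ℂ)) • (wloc + wlocᴴ))))) *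
        (∑ v : TorusSite 2 L, relabel (Orb.translate v)
          (fermionEmbed (PolySite.toTorusEmb L (hInjw L hL)) (((1 / 2 : ℂ)) • (wloc + wlocᴴ))))) *ᵥ χ)).re| ≤
        DN * (L : ℝ) ^ 2)
    (hDDN₂ : ∀ (L : ℕ) [NeZero L] (hL : L₁ ≤ L), LN ≤ L → ∀ χ : Fock (Orb (FermionTorus 2 L)), star χ ⬝ᵥ χ = 1 →
      |(star χ ⬝ᵥ (((∑ v : TorusSite 2 L, relabel (Orb.translate v)
          (fermionEmbed (PolySite.toTorusEmb L (hInjw L hL)) ((I / 2 : ℂ) • (wlocᴴ - wloc)))) *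
        ((∑ v : TorusSite 2 L, relabel (Orb.translate v)
          (fermionEmbed (PolySite.toTorusEmb L (hInjw L hL)) ((I / 2 : ℂ) • (wlocᴴ - wloc)))) * totalNumber -
          totalNumber * (∑ v : TorusSite 2 L, relabel (Orb.translate v)
          (fermionEmbed (PolySite.toTorusEmb L (hInjw L hL)) ((I / 2 : ℂ) • (wlocᴴ - wloc))))) -
        ((∑ v : TorusSite 2 L, relabel (Orb.translate v)
          (fermionEmbed (PolySite.toTorusEmb L (hInjw L hL)) ((I / 2 : ℂ) • (wlocᴴ - wloc)))) * totalNumber -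
          totalNumber * (∑ v : TorusSite 2 L, relabel (Orb.translate v)
          (fermionEmbed (PolySite.toTorusEmb L (hInjw L hL)) ((I / 2 : ℂ) • (wlocᴴ - wloc))))) *
        (∑ v : TorusSite 2 L, relabel (Orb.translate v)
          (fermionEmbed (PolySite.toTorusEmb L (hInjw L hL)) ((I / 2 : ℂ) • (wlocᴴ - wloc))))) *ᵥ χ)).re| ≤
        DN * (L : ℝ) ^ 2)
    -- the one-point size of the charge of `W_L`: `|Re⟨ζ,(N̂W − WN̂)ζ⟩| ≤ C_q·L²`
    (hWq : ∀ (L : ℕ) [NeZero L] (hL : L₁ ≤ L) (ζ : Fock (Orb (FermionTorus 2 L))), star ζ ⬝ᵥ ζ = 1 →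
      |(star ζ ⬝ᵥ ((totalNumber * (∑ v : TorusSite 2 L, relabel (Orb.translate v)
          (fermionEmbed (PolySite.toTorusEmb L (hInjw L hL)) wloc)) -
        (∑ v : TorusSite 2 L, relabel (Orb.translate v)
          (fermionEmbed (PolySite.toTorusEmb L (hInjw L hL)) wloc)) * totalNumber) *ᵥ ζ)).re| ≤ Cq * (L : ℝ) ^ 2)
    -- the node, with its charged row at the GRID chemical potential `μ'`
    (hboundC' : ∀ (L : ℕ) [NeZero L] (hL : L₁ ≤ L) (ζ : Fock (Orb (FermionTorus 2 L))), star ζ ⬝ᵥ ζ = 1 →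
      c - A + ∑ σ : Fin 2, μ σ *
          ((star ζ ⬝ᵥ ((∑ y : FermionTorus 2 L, numberOp y σ) *ᵥ ζ)).re / (L : ℝ) ^ 2 - ν) +
        κ * (u - (star ζ ⬝ᵥ (hubbardTorusTT' L t t' U *ᵥ ζ)).re / (L : ℝ) ^ 2) +
        (star ζ ⬝ᵥ (((hubbardTorusTT' L t t' U - (μ' : ℂ) • totalNumber) *
              (∑ v : TorusSite 2 L, relabel (Orb.translate v)
                (fermionEmbed (PolySite.toTorusEmb L (hInjw L hL)) wloc)) -
            (∑ v : TorusSite 2 L, relabel (Orb.translate v)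
                (fermionEmbed (PolySite.toTorusEmb L (hInjw L hL)) wloc)) *
              (hubbardTorusTT' L t t' U - (μ' : ℂ) • totalNumber)) *ᵥ ζ)).re / (L : ℝ) ^ 2 ≤
        -((expect (pairField g L) ζ).re / (L : ℝ) ^ 2))
    (ψ : ∀ L, Fock (Orb (FermionTorus 2 L)))
    (hψ : ∀ L, IsGroundStateInSector (hubbardTorusTT' L t t' U) (rectN n L) 0 (ψ L))
    (hψ1 : ∀ L, star (ψ L) ⬝ᵥ ψ L = 1) :
    liminf (fun k : ℕ => (∑ x ∈ halfOpenBox 2 (2 * k), ∑ y ∈ halfOpenBox 2 (2 * k),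
        torusPullback (pairFieldCorr g ψ) (2 * k) x y) / ((#(halfOpenBox 2 (2 * k)) : ℝ)) ^ 2) atTop ≤
      (c - Δ * Cq - A + (∑ σ : Fin 2, μ σ) * (n / 2 - ν)) ^ 2 := by
  refine liminf_pairFieldLRO_le_sq_of_onePoint_chargedStationary_bound_TT' g t t' hU hn0 hn2 μ hκ hu hμc
    wloc hweven hwevenH L₁ hInjw LN hDN hDDN₁ hDDN₂ ?_ ψ hψ hψ1
  intro L _ hL ζ hζ
  have hnode := hboundC' L hL ζ hζ
  have hq := hWq L hL ζ hζ
  set H := hubbardTorusTT' L t t' U with hH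
  set W := ∑ v : TorusSite 2 L, relabel (Orb.translate v) (fermionEmbed (PolySite.toTorusEmb L (hInjw L hL)) wloc)
    with hW
  have hL0 : (0 : ℝ) < (L : ℝ) := Nat.cast_pos.2 (Nat.pos_of_ne_zero (NeZero.ne L))
  have hL2 : (0 : ℝ) < (L : ℝ) ^ 2 := by positivity
  -- move the row from `μ'` to `μc`
  have e : (H - (μc : ℂ) • totalNumber) * W - W * (H - (μc : ℂ) • totalNumber) =
      ((H - (μ' : ℂ) • totalNumber) * W - W * (H - (μ' : ℂ) • totalNumber)) +
        (((μ' - μc : ℝ) : ℂ)) • (totalNumber * W - W * totalNumber) := by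
    rw [Complex.ofReal_sub]
    exact commutator_sub_smul_totalNumber_shift H totalNumber W (μc : ℂ) (μ' : ℂ)
  have hrow : (star ζ ⬝ᵥ (((H - (μc : ℂ) • totalNumber) * W - W * (H - (μc : ℂ) • totalNumber)) *ᵥ ζ)).re =
      (star ζ ⬝ᵥ ((((H - (μ' : ℂ) • totalNumber) * W - W * (H - (μ' : ℂ) • totalNumber))) *ᵥ ζ)).re +
        (μ' - μc) * (star ζ ⬝ᵥ ((totalNumber * W - W * totalNumber) *ᵥ ζ)).re := by
    rw [e, add_mulVec, smul_mulVec, dotProduct_add, dotProduct_smul, smul_eq_mul, Complex.add_re,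
      Complex.re_ofReal_mul]
  -- the perturbation is at most `Δ·Cq·L²`
  have hpert : |(μ' - μc) * (star ζ ⬝ᵥ ((totalNumber * W - W * totalNumber) *ᵥ ζ)).re| ≤ Δ * (Cq * (L : ℝ) ^ 2) := by
    rw [abs_mul]
    exact mul_le_mul hnear hq (abs_nonneg _) ((abs_nonneg _).trans hnear)
  have hpert' := (abs_le.1 hpert).2
  have hdiv : (star ζ ⬝ᵥ (((H - (μc : ℂ) • totalNumber) * W - W * (H - (μc : ℂ) • totalNumber)) *ᵥ ζ)).re /
      (L : ℝ) ^ 2 ≤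
      (star ζ ⬝ᵥ ((((H - (μ' : ℂ) • totalNumber) * W - W * (H - (μ' : ℂ) • totalNumber))) *ᵥ ζ)).re /
        (L : ℝ) ^ 2 + Δ * Cq := by
    rw [hrow, add_div]
    have h1 : (μ' - μc) * (star ζ ⬝ᵥ ((totalNumber * W - W * totalNumber) *ᵥ ζ)).re / (L : ℝ) ^ 2 ≤ Δ * Cq := by
      rw [div_le_iff₀ hL2]
      linarith
    linarith
  linarith [hnode, hdiv]

/-- **A grid-point node is a node at every nearby chemical potential, with interval slack** (the hypothesis
form, for cell consumers stated in the shape of `liminf_pairFieldLRO_le_sq_of_onePoint_chargedStationary_bound_TT'`):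
if the one-point bound holds with the charged row at `μ'` and constant `c`, and `|Re⟨ζ,(N̂W_L − W_LN̂)ζ⟩| ≤ C_q·L²`,
then for every `μc` with `|μ' − μc| ≤ Δ` it holds with the charged row at `μc` and constant `c − Δ·C_q`.
[cite: KomaTasaki1994, Theorem 5] [cite: Ruelle1969, §3.4] -/
theorem onePoint_chargedStationary_bound_of_gridNode (t t' U : ℝ) {c A κ u ν : ℝ} (μ : Fin 2 → ℝ)
    {μc μ' Δ Cq : ℝ} (hnear : |μ' - μc| ≤ Δ) {Λw : Finset (Site 2)} (wloc : FermionOp Λw) (L₁ : ℕ)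
    (hInjw : ∀ L : ℕ, L₁ ≤ L → Set.InjOn (Torus.proj (d := 2) L) ↑Λw)
    (hWq : ∀ (L : ℕ) [NeZero L] (hL : L₁ ≤ L) (ζ : Fock (Orb (FermionTorus 2 L))), star ζ ⬝ᵥ ζ = 1 →
      |(star ζ ⬝ᵥ ((totalNumber * (∑ v : TorusSite 2 L, relabel (Orb.translate v)
          (fermionEmbed (PolySite.toTorusEmb L (hInjw L hL)) wloc)) -
        (∑ v : TorusSite 2 L, relabel (Orb.translate v)
          (fermionEmbed (PolySite.toTorusEmb L (hInjw L hL)) wloc)) * totalNumber) *ᵥ ζ)).re| ≤ Cq * (L : ℝ) ^ 2)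
    (hboundC' : ∀ (L : ℕ) [NeZero L] (hL : L₁ ≤ L) (ζ : Fock (Orb (FermionTorus 2 L))), star ζ ⬝ᵥ ζ = 1 →
      c - A + ∑ σ : Fin 2, μ σ *
          ((star ζ ⬝ᵥ ((∑ y : FermionTorus 2 L, numberOp y σ) *ᵥ ζ)).re / (L : ℝ) ^ 2 - ν) +
        κ * (u - (star ζ ⬝ᵥ (hubbardTorusTT' L t t' U *ᵥ ζ)).re / (L : ℝ) ^ 2) +
        (star ζ ⬝ᵥ (((hubbardTorusTT' L t t' U - (μ' : ℂ) • totalNumber) *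
              (∑ v : TorusSite 2 L, relabel (Orb.translate v)
                (fermionEmbed (PolySite.toTorusEmb L (hInjw L hL)) wloc)) -
            (∑ v : TorusSite 2 L, relabel (Orb.translate v)
                (fermionEmbed (PolySite.toTorusEmb L (hInjw L hL)) wloc)) *
              (hubbardTorusTT' L t t' U - (μ' : ℂ) • totalNumber)) *ᵥ ζ)).re / (L : ℝ) ^ 2 ≤
        -((expect (pairField g L) ζ).re / (L : ℝ) ^ 2))
    (L : ℕ) [NeZero L] (hL : L₁ ≤ L) (ζ : Fock (Orb (FermionTorus 2 L))) (hζ : star ζ ⬝ᵥ ζ = 1) :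
    c - Δ * Cq - A + ∑ σ : Fin 2, μ σ *
        ((star ζ ⬝ᵥ ((∑ y : FermionTorus 2 L, numberOp y σ) *ᵥ ζ)).re / (L : ℝ) ^ 2 - ν) +
      κ * (u - (star ζ ⬝ᵥ (hubbardTorusTT' L t t' U *ᵥ ζ)).re / (L : ℝ) ^ 2) +
      (star ζ ⬝ᵥ (((hubbardTorusTT' L t t' U - (μc : ℂ) • totalNumber) *
            (∑ v : TorusSite 2 L, relabel (Orb.translate v)
              (fermionEmbed (PolySite.toTorusEmb L (hInjw L hL)) wloc)) -
          (∑ v : TorusSite 2 L, relabel (Orb.translate v)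
              (fermionEmbed (PolySite.toTorusEmb L (hInjw L hL)) wloc)) *
            (hubbardTorusTT' L t t' U - (μc : ℂ) • totalNumber)) *ᵥ ζ)).re / (L : ℝ) ^ 2 ≤
      -((expect (pairField g L) ζ).re / (L : ℝ) ^ 2) := by
  have hnode := hboundC' L hL ζ hζ
  have hq := hWq L hL ζ hζ
  set H := hubbardTorusTT' L t t' U with hH
  set W := ∑ v : TorusSite 2 L, relabel (Orb.translate v) (fermionEmbed (PolySite.toTorusEmb L (hInjw L hL)) wloc)
    with hW
  have hL0 : (0 : ℝ) < (L : ℝ) := Nat.cast_pos.2 (Nat.pos_of_ne_zero (NeZero.ne L))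
  have hL2 : (0 : ℝ) < (L : ℝ) ^ 2 := by positivity
  have e : (H - (μc : ℂ) • totalNumber) * W - W * (H - (μc : ℂ) • totalNumber) =
      ((H - (μ' : ℂ) • totalNumber) * W - W * (H - (μ' : ℂ) • totalNumber)) +
        (((μ' - μc : ℝ) : ℂ)) • (totalNumber * W - W * totalNumber) := by
    rw [Complex.ofReal_sub]
    exact commutator_sub_smul_totalNumber_shift H totalNumber W (μc : ℂ) (μ' : ℂ)
  have hrow : (star ζ ⬝ᵥ (((H - (μc : ℂ) • totalNumber) * W - W * (H - (μc : ℂ) • totalNumber)) *ᵥ ζ)).re =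
      (star ζ ⬝ᵥ ((((H - (μ' : ℂ) • totalNumber) * W - W * (H - (μ' : ℂ) • totalNumber))) *ᵥ ζ)).re +
        (μ' - μc) * (star ζ ⬝ᵥ ((totalNumber * W - W * totalNumber) *ᵥ ζ)).re := by
    rw [e, add_mulVec, smul_mulVec, dotProduct_add, dotProduct_smul, smul_eq_mul, Complex.add_re,
      Complex.re_ofReal_mul]
  have hpert : |(μ' - μc) * (star ζ ⬝ᵥ ((totalNumber * W - W * totalNumber) *ᵥ ζ)).re| ≤ Δ * (Cq * (L : ℝ) ^ 2) := by
    rw [abs_mul]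
    exact mul_le_mul hnear hq (abs_nonneg _) ((abs_nonneg _).trans hnear)
  have hpert' := (abs_le.1 hpert).2
  have hdiv : (star ζ ⬝ᵥ (((H - (μc : ℂ) • totalNumber) * W - W * (H - (μc : ℂ) • totalNumber)) *ᵥ ζ)).re /
      (L : ℝ) ^ 2 ≤
      (star ζ ⬝ᵥ ((((H - (μ' : ℂ) • totalNumber) * W - W * (H - (μ' : ℂ) • totalNumber))) *ᵥ ζ)).re /
        (L : ℝ) ^ 2 + Δ * Cq := by
    rw [hrow, add_div]
    have h1 : (μ' - μc) * (star ζ ⬝ᵥ ((totalNumber * W - W * totalNumber) *ᵥ ζ)).re / (L : ℝ) ^ 2 ≤ Δ * Cq := by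
      rw [div_le_iff₀ hL2]
      linarith
    linarith
  linarith [hnode, hdiv]

end Near

end Summit.Ventures.CertifiedManyBodySolver.Observables

end
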